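import Summits.QuantumFields.BalabanUV.Beta.DeGiorgiStep

/-!
# Beta / DeGiorgiIteration — DE GIORGI'S ITERATION ON A TORUS BOX FOR THE FREE LATTICE LAPLACIAN: along dyadic radii and levels the
# truncated masses decay geometrically (`U_j ≤ U_0·2^{−j(d+2)}`), and the DISCRETE TERMINATION «no site of the last ball exceeds the
# last level» bounds the sub-solution at the centre by `k = √(U_0/(θ_d·2^{md}))` (MODEL; unit torus `UT N`, constant bond weight;
# fourth module of «LATTICE-DEGIORGI-MV»)

SETTING: as `DeGiorgiStep` — `UT N`, bonds `bsrc∕btgt`, constant weight `c ≡ c₀ ≠ 0`, centre `x₀`, outer radius `R` with `10R + 4 ≤ N_i`,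
`z ≥ 0` a sub-solution (`W·z ≤ Nz`) on the ball `dist(·, x₀) ≤ R`; a dyadic depth `m` with `2^{m+1} ≤ R`.
DATA OF THE ITERATION: radii `rad j = R − 2^{m+1} + 2^{m+1−j}` (`rad 0 = R`, gaps `2^{m−j}`, `m + 1` honest integer steps), levels
`lev j = k − k/2^j` (`lev 0 = 0`, increments `k/2^{j+1}`), masses `Useq j = Σ_{dist ≤ rad j} (z − lev j)₊²`, and the explicit constants
`τ_d = 1/√(416d²·2^{d+2})` (so that `416d²τ² = 2^{−(d+2)}`), `θ_d = τ_d^d/16 < 1/16`.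
CONTENT (kernel, 0 sorry): §1 the constants; §2 the arithmetic of radii and levels; §3 **`iter`**: if `U_0 ≤ k²·θ_d·2^{md}` then
`Useq j ≤ U_0/2^{j(d+2)}` for all `j ≤ m + 1` — induction on `j`, each step being `DeGiorgiStep.step` with gap `s = 2^{m−j}`, increment
`δ = k/2^{j+1}` and `X = τ_d·2^{m−j}` (the induction hypothesis gives exactly `4U_j/δ² ≤ X^d`, and `416d²X²/s² = 2^{−(d+2)}`); §4
**`le_of_iteration`**: `U_{m+1} < (k/2^{m+2})²` (as `θ_d < 1/16`), hence NO site of the ball `dist ≤ rad(m+1)` has `z > lev(m+1) + k/2^{m+2}`,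
so **`z ≤ k` on that ball, in particular `z(x₀) ≤ k`**.  The END (choice of `m`, `k`, the mean-value binder and `hreg`'s shape) is the next
module `SubsolutionMeanValueBox` (unit `b2b-balaban-beta-d4-p2`, GEN 10, MODEL crew; claim «LATTICE-DEGIORGI-MV» journal l.22396).

HONEST FRAMING: discharging `BetaPertH` makes Bałaban's UV stability UNCONDITIONAL — NOT the continuum limit, NOT the
Clay problem.  HONEST DEPENDENCY (verbatim): «continuum YM on T⁴ ⇐ BetaPertH ∧ nine spine estimates (0/9 proved);
BetaPertH ⇐ (D1) ∧ (D4) ∧ CAP+tail; G-an2-4 gates asym, D1 and NE2/3/4.»  THIS MODULE DISCHARGES NOTHING of `BetaPertH`,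
asserts NOTHING printed and cites nothing as a fact (ABSOLUTE RULE): [folklore] finite lattice calculus (De Giorgi 1957 — method pointer
only).  No class change on row D4 (critical-path width 0; D4 DISCHARGE NO DATE); NOT BetaPertH, NOT continuum, NOT Clay, NOT summit progress.
-/

open scoped BigOperators
open Finset

namespace Summit.QuantumFields.BalabanUV.Beta.DeGiorgiIteration

open Literature.MathematicalPhysics.QuantumFieldTheory.Balaban1983to89
open Literature.MathematicalPhysics.QuantumFieldTheory.Balaban1983to89.B9Thm37GluePU (bsrc btgt)
open B5TorusCover (UT)
open Summit.QuantumFields.BalabanUV.Beta.DeGiorgiStep (step)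

noncomputable section

variable {d : ℕ} {N : Fin d → ℕ} [∀ i, NeZero (N i)]

/-! ## §1 The constants -/

/-- `τ_d = 1/√(416·d²·2^{d+2})`. [folklore] -/
def tau (d : ℕ) : ℝ := 1 / Real.sqrt (416 * (d : ℝ) ^ 2 * 2 ^ (d + 2))

/-- `θ_d = τ_d^d/16`. [folklore] -/
def theta (d : ℕ) : ℝ := tau d ^ d / 16

omit [∀ i, NeZero (N i)] in
/-- `τ_d > 0` for `d ≥ 1`. [folklore] -/
theorem tau_pos {d : ℕ} (hd : 1 ≤ d) : 0 < tau d := by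
  unfold tau
  have : (0 : ℝ) < 416 * (d : ℝ) ^ 2 * 2 ^ (d + 2) := by
    have : (1 : ℝ) ≤ d := by exact_mod_cast hd
    positivity
  exact div_pos one_pos (Real.sqrt_pos.mpr this)

omit [∀ i, NeZero (N i)] in
/-- **The contraction identity** `416·d²·τ_d² = 1/2^{d+2}`. [folklore] -/
theorem tau_sq {d : ℕ} (hd : 1 ≤ d) : 416 * (d : ℝ) ^ 2 * tau d ^ 2 = 1 / 2 ^ (d + 2) := by
  unfold tau
  have hpos : (0 : ℝ) < 416 * (d : ℝ) ^ 2 * 2 ^ (d + 2) := by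
    have : (1 : ℝ) ≤ d := by exact_mod_cast hd
    positivity
  rw [div_pow, one_pow, Real.sq_sqrt hpos.le]
  field_simp

omit [∀ i, NeZero (N i)] in
/-- `θ_d > 0` for `d ≥ 1`. [folklore] -/
theorem theta_pos {d : ℕ} (hd : 1 ≤ d) : 0 < theta d := by
  unfold theta; exact div_pos (pow_pos (tau_pos hd) d) (by norm_num)

omit [∀ i, NeZero (N i)] in
/-- `θ_d < 1/16` (`τ_d < 1`). [folklore] -/
theorem theta_lt {d : ℕ} (hd : 1 ≤ d) : theta d < 1 / 16 := by
  unfold theta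
  have hτ1 : tau d < 1 := by
    unfold tau
    have h16 : (16 : ℝ) ≤ 416 * (d : ℝ) ^ 2 * 2 ^ (d + 2) := by
      have h1 : (1 : ℝ) ≤ d := by exact_mod_cast hd
      have h2 : (1 : ℝ) ≤ (d : ℝ) ^ 2 := one_le_pow₀ h1
      have h3 : (1 : ℝ) ≤ 2 ^ (d + 2) := one_le_pow₀ (by norm_num)
      nlinarith
    have h4 : (4 : ℝ) ≤ Real.sqrt (416 * (d : ℝ) ^ 2 * 2 ^ (d + 2)) := by
      rw [show (4 : ℝ) = Real.sqrt 16 by rw [show (16 : ℝ) = 4 ^ 2 by norm_num, Real.sqrt_sq (by norm_num)]]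
      exact Real.sqrt_le_sqrt h16
    rw [div_lt_one (by linarith)]
    linarith
  have hτd : tau d ^ d < 1 := pow_lt_one₀ (tau_pos hd).le hτ1 (by omega)
  linarith

/-! ## §2 Radii and levels -/

/-- The dyadic radii `rad j = R − 2^{m+1} + 2^{m+1−j}`. [folklore] -/
def rad (R m j : ℕ) : ℕ := R - 2 ^ (m + 1) + 2 ^ (m + 1 - j)

/-- The levels `lev j = k − k/2^j`. [folklore] -/
def lev (k : ℝ) (j : ℕ) : ℝ := k - k / 2 ^ j

omit [∀ i, NeZero (N i)] in
/-- `rad 0 = R`. [folklore] -/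
theorem rad_zero {R m : ℕ} (hm : 2 ^ (m + 1) ≤ R) : rad R m 0 = R := by
  unfold rad; rw [Nat.sub_zero]; omega

omit [∀ i, NeZero (N i)] in
/-- One step of the radii: `rad j − 2^{m−j} = rad (j+1)` for `j ≤ m`. [folklore] -/
theorem rad_succ {R m j : ℕ} (hm : 2 ^ (m + 1) ≤ R) (hj : j ≤ m) : rad R m j - 2 ^ (m - j) = rad R m (j + 1) := by
  unfold rad
  have e1 : m + 1 - (j + 1) = m - j := by omega
  have e2 : 2 ^ (m + 1 - j) = 2 * 2 ^ (m - j) := by rw [show m + 1 - j = (m - j) + 1 by omega, pow_succ]; ring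
  rw [e1, e2]
  omega

omit [∀ i, NeZero (N i)] in
/-- The gap fits: `2^{m−j} ≤ rad j`. [folklore] -/
theorem gap_le_rad {R m j : ℕ} (hj : j ≤ m) : 2 ^ (m - j) ≤ rad R m j := by
  unfold rad
  have e2 : 2 ^ (m + 1 - j) = 2 * 2 ^ (m - j) := by rw [show m + 1 - j = (m - j) + 1 by omega, pow_succ]; ring
  rw [e2]; omega

omit [∀ i, NeZero (N i)] in
/-- `rad j ≤ R`. [folklore] -/
theorem rad_le {R m : ℕ} (hm : 2 ^ (m + 1) ≤ R) (j : ℕ) : rad R m j ≤ R := by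
  unfold rad
  have : 2 ^ (m + 1 - j) ≤ 2 ^ (m + 1) := Nat.pow_le_pow_right (by norm_num) (by omega)
  omega

omit [∀ i, NeZero (N i)] in
/-- `lev 0 = 0`. [folklore] -/
theorem lev_zero (k : ℝ) : lev k 0 = 0 := by unfold lev; simp

omit [∀ i, NeZero (N i)] in
/-- One step of the levels: `lev j + k/2^{j+1} = lev (j+1)`. [folklore] -/
theorem lev_succ (k : ℝ) (j : ℕ) : lev k j + k / 2 ^ (j + 1) = lev k (j + 1) := by
  unfold lev
  rw [pow_succ]
  field_simp
  ring

omit [∀ i, NeZero (N i)] in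
/-- `lev j ≤ k` for `k ≥ 0`. [folklore] -/
theorem lev_le {k : ℝ} (hk : 0 ≤ k) (j : ℕ) : lev k j ≤ k := by
  unfold lev
  have : 0 ≤ k / 2 ^ j := by positivity
  linarith

/-! ## §3 The iteration -/

/-- The truncated masses `Useq j = Σ_{dist ≤ rad j} (z − lev j)₊²`. [folklore] -/
def Useq (z : UT N → ℝ) (x₀ : UT N) (R m : ℕ) (k : ℝ) (j : ℕ) : ℝ :=
  ∑ x ∈ univ.filter (fun x : UT N => dist x x₀ ≤ ((rad R m j : ℕ) : ℝ)), max (z x - lev k j) 0 ^ 2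

/-- `Useq j ≥ 0`. [folklore] -/
theorem Useq_nonneg (z : UT N → ℝ) (x₀ : UT N) (R m : ℕ) (k : ℝ) (j : ℕ) : 0 ≤ Useq z x₀ R m k j :=
  Finset.sum_nonneg fun _ _ => sq_nonneg _

/-- `Useq 0 = Σ_{dist ≤ R} z²` for `z ≥ 0`. [folklore] -/
theorem Useq_zero (z : UT N → ℝ) (hz0 : ∀ y, 0 ≤ z y) (x₀ : UT N) {R m : ℕ} (hm : 2 ^ (m + 1) ≤ R) (k : ℝ) :
    Useq z x₀ R m k 0 = ∑ x ∈ univ.filter (fun x : UT N => dist x x₀ ≤ (R : ℝ)), z x ^ 2 := by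
  unfold Useq
  rw [rad_zero hm, lev_zero]
  exact Finset.sum_congr rfl fun x _ => by rw [sub_zero, max_eq_left (hz0 x)]

/-- **THE GEOMETRIC DECAY OF THE TRUNCATED MASSES.**  If `U_0 ≤ k²·θ_d·2^{md}` (`k > 0`), then `Useq j ≤ U_0/2^{j(d+2)}` for every
`j ≤ m + 1`. [folklore] -/
theorem iter [NeZero d] {c : UT N × Fin d → ℝ} {c₀ : ℝ} (hc : ∀ b, c b = c₀) (hc₀ : c₀ ≠ 0) (x₀ : UT N) {R m : ℕ}
    (hm : 2 ^ (m + 1) ≤ R) (hN : ∀ i, 10 * R + 4 ≤ N i) (z : UT N → ℝ)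
    (hz : ∀ x ∈ univ.filter (fun x : UT N => dist x x₀ ≤ R),
      ((∑ b ∈ univ.filter (fun b : UT N × Fin d => btgt b = x), c b ^ 2) +
          ∑ b ∈ univ.filter (fun b : UT N × Fin d => bsrc b = x), c b ^ 2) * z x ≤
        ((∑ b ∈ univ.filter (fun b : UT N × Fin d => btgt b = x), c b ^ 2 * z (bsrc b)) +
          ∑ b ∈ univ.filter (fun b : UT N × Fin d => bsrc b = x), c b ^ 2 * z (btgt b)))
    {k : ℝ} (hk : 0 < k) (hkU : Useq z x₀ R m k 0 ≤ k ^ 2 * theta d * 2 ^ (m * d)) :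
    ∀ j, j ≤ m + 1 → Useq z x₀ R m k j ≤ Useq z x₀ R m k 0 / 2 ^ (j * (d + 2)) := by
  have hd1 : 1 ≤ d := Nat.one_le_iff_ne_zero.mpr (NeZero.ne d)
  intro j
  induction j with
  | zero => intro _; simp
  | succ j ih =>
    intro hj
    have hjm : j ≤ m := by omega
    have IH := ih (by omega)
    obtain ⟨t, ht⟩ : ∃ t, m = j + t := ⟨m - j, by omega⟩
    have hmj : m - j = t := by omega
    -- the atoms `P = 2^j`, `Q = 2^t`
    set P : ℝ := 2 ^ j with hP
    set Q : ℝ := 2 ^ t with hQ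
    have hP0 : 0 < P := by positivity
    have hQ0 : 0 < Q := by positivity
    have hτ := tau_pos hd1
    -- the step with `ρ = rad j`, `s = 2^{m-j}`, `l = lev j`, `δ = k/2^{j+1}`, `X = τ·2^{m-j}`
    have hs1 : 1 ≤ 2 ^ (m - j) := Nat.one_le_two_pow
    have hX : 4 * (∑ x ∈ univ.filter (fun x : UT N => dist x x₀ ≤ ((rad R m j : ℕ) : ℝ)), max (z x - lev k j) 0 ^ 2) /
        (k / 2 ^ (j + 1)) ^ 2 ≤ (tau d * ((2 ^ (m - j) : ℕ) : ℝ)) ^ d := by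
      have hU : (∑ x ∈ univ.filter (fun x : UT N => dist x x₀ ≤ ((rad R m j : ℕ) : ℝ)), max (z x - lev k j) 0 ^ 2) =
          Useq z x₀ R m k j := rfl
      rw [hU]
      have e0 : ((2 ^ (m - j) : ℕ) : ℝ) = Q := by rw [hmj]; push_cast; rfl
      have e1 : (2 : ℝ) ^ (j * (d + 2)) = P ^ (d + 2) := by rw [pow_mul]
      have e2 : (2 : ℝ) ^ (m * d) = (P * Q) ^ d := by rw [ht, ← pow_add, ← pow_mul]
      have e3 : (2 : ℝ) ^ (j + 1) = 2 * P := by rw [pow_succ]; ring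
      rw [e0, e3]
      rw [e1] at IH; rw [e2] at hkU
      have e4 : 4 * (Useq z x₀ R m k j) / (k / (2 * P)) ^ 2 = 16 * Useq z x₀ R m k j / (k ^ 2 / P ^ 2) := by
        field_simp; ring
      have hle : Useq z x₀ R m k j ≤ k ^ 2 * theta d * (P * Q) ^ d / P ^ (d + 2) :=
        IH.trans (div_le_div_of_nonneg_right hkU (by positivity))
      rw [e4, div_le_iff₀ (by positivity)]
      calc 16 * Useq z x₀ R m k j ≤ 16 * (k ^ 2 * theta d * (P * Q) ^ d / P ^ (d + 2)) := by linarith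
        _ = (tau d * Q) ^ d * (k ^ 2 / P ^ 2) := by unfold theta; field_simp; ring
    have hstep := step hc hc₀ x₀ hN z hz hs1 (gap_le_rad (R := R) hjm) (rad_le hm j) (lev k j) (δ := k / 2 ^ (j + 1))
      (by positivity) (X := tau d * ((2 ^ (m - j) : ℕ) : ℝ)) (by positivity) hX
    rw [rad_succ hm hjm, lev_succ] at hstep
    -- `416 d² X²/s² = 416 d² τ² = 2^{-(d+2)}`
    have hcontr : 416 * (d : ℝ) ^ 2 * (tau d * ((2 ^ (m - j) : ℕ) : ℝ)) ^ 2 / (((2 ^ (m - j) : ℕ) : ℕ) : ℝ) ^ 2 = 1 / 2 ^ (d + 2) := by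
      rw [← tau_sq hd1]
      have : (0 : ℝ) < ((2 ^ (m - j) : ℕ) : ℝ) := by positivity
      field_simp
    have hU' : Useq z x₀ R m k (j + 1) =
        ∑ x ∈ univ.filter (fun x : UT N => dist x x₀ ≤ ((rad R m (j + 1) : ℕ) : ℝ)), max (z x - lev k (j + 1)) 0 ^ 2 := rfl
    rw [hU']
    refine hstep.trans ?_
    rw [hcontr]
    have hU : (∑ x ∈ univ.filter (fun x : UT N => dist x x₀ ≤ ((rad R m j : ℕ) : ℝ)), max (z x - lev k j) 0 ^ 2) =
        Useq z x₀ R m k j := rfl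
    rw [hU]
    calc 1 / 2 ^ (d + 2) * Useq z x₀ R m k j ≤ 1 / 2 ^ (d + 2) * (Useq z x₀ R m k 0 / 2 ^ (j * (d + 2))) :=
          mul_le_mul_of_nonneg_left IH (by positivity)
      _ = Useq z x₀ R m k 0 / 2 ^ ((j + 1) * (d + 2)) := by
          rw [show (j + 1) * (d + 2) = j * (d + 2) + (d + 2) by ring, pow_add]
          field_simp
          ring

/-! ## §4 The discrete termination -/

/-- **THE TERMINATION OF THE ITERATION**: under the hypotheses of `iter`, the last truncated mass is below the square of the last
increment, `U_{m+1} < (k/2^{m+2})²`, so no site of the ball `dist ≤ rad(m+1)` exceeds `lev(m+1) + k/2^{m+2} ≤ k`: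
**`z(x) ≤ k` on that ball**. [folklore] -/
theorem le_of_iteration [NeZero d] {c : UT N × Fin d → ℝ} {c₀ : ℝ} (hc : ∀ b, c b = c₀) (hc₀ : c₀ ≠ 0) (x₀ : UT N) {R m : ℕ}
    (hm : 2 ^ (m + 1) ≤ R) (hN : ∀ i, 10 * R + 4 ≤ N i) (z : UT N → ℝ)
    (hz : ∀ x ∈ univ.filter (fun x : UT N => dist x x₀ ≤ R),
      ((∑ b ∈ univ.filter (fun b : UT N × Fin d => btgt b = x), c b ^ 2) +
          ∑ b ∈ univ.filter (fun b : UT N × Fin d => bsrc b = x), c b ^ 2) * z x ≤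
        ((∑ b ∈ univ.filter (fun b : UT N × Fin d => btgt b = x), c b ^ 2 * z (bsrc b)) +
          ∑ b ∈ univ.filter (fun b : UT N × Fin d => bsrc b = x), c b ^ 2 * z (btgt b)))
    {k : ℝ} (hk : 0 < k) (hkU : Useq z x₀ R m k 0 ≤ k ^ 2 * theta d * 2 ^ (m * d))
    {x : UT N} (hx : dist x x₀ ≤ ((rad R m (m + 1) : ℕ) : ℝ)) : z x ≤ k := by
  have hd1 : 1 ≤ d := Nat.one_le_iff_ne_zero.mpr (NeZero.ne d)
  have hJ := iter hc hc₀ x₀ hm hN z hz hk hkU (m + 1) le_rfl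
  -- `U_{m+1} < (k/2^{m+2})²`
  set M : ℝ := 2 ^ m with hM
  have hM0 : 0 < M := by positivity
  have hθ := theta_lt hd1
  have hθ0 := theta_pos hd1
  have hlt : Useq z x₀ R m k (m + 1) < (k / 2 ^ (m + 2)) ^ 2 := by
    have h1 : Useq z x₀ R m k (m + 1) ≤ k ^ 2 * theta d * 2 ^ (m * d) / 2 ^ ((m + 1) * (d + 2)) :=
      hJ.trans (div_le_div_of_nonneg_right hkU (by positivity))
    refine lt_of_le_of_lt h1 ?_
    have e1 : (2 : ℝ) ^ (m * d) = M ^ d := by rw [hM, pow_mul]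
    have e2 : (2 : ℝ) ^ ((m + 1) * (d + 2)) = (2 * M) ^ (d + 2) := by rw [hM, ← pow_succ', ← pow_mul]
    have e3 : (2 : ℝ) ^ (m + 2) = 4 * M := by rw [hM, pow_add]; ring
    rw [e1, e2, e3, div_lt_iff₀ (by positivity), div_pow, div_mul_eq_mul_div, lt_div_iff₀ (by positivity)]
    have h2d : (1 : ℝ) ≤ 2 ^ d := one_le_pow₀ (by norm_num)
    have e4 : k ^ 2 * theta d * M ^ d * (4 * M) ^ 2 = 16 * theta d * (k ^ 2 * M ^ (d + 2)) := by ring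
    have e5 : k ^ 2 * (2 * M) ^ (d + 2) = (4 * 2 ^ d) * (k ^ 2 * M ^ (d + 2)) := by ring
    rw [e4, e5]
    have hpos : 0 < k ^ 2 * M ^ (d + 2) := by positivity
    nlinarith
  -- no site of the last ball exceeds the last level
  by_contra hzx
  push Not at hzx
  have hmem : x ∈ univ.filter (fun y : UT N => dist y x₀ ≤ ((rad R m (m + 1) : ℕ) : ℝ)) :=
    Finset.mem_filter.mpr ⟨Finset.mem_univ _, hx⟩
  have hterm : (k / 2 ^ (m + 2)) ^ 2 < max (z x - lev k (m + 1)) 0 ^ 2 := by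
    have hgap : k / 2 ^ (m + 2) < z x - lev k (m + 1) := by
      have e : lev k (m + 1) + k / 2 ^ (m + 2) = lev k (m + 2) := lev_succ k (m + 1)
      have h2 := lev_le hk.le (m + 2)
      linarith
    have h0 : 0 ≤ k / 2 ^ (m + 2) := by positivity
    rw [max_eq_left (by linarith)]
    exact pow_lt_pow_left₀ hgap h0 two_ne_zero
  have hsum : max (z x - lev k (m + 1)) 0 ^ 2 ≤ Useq z x₀ R m k (m + 1) := by
    unfold Useq
    exact Finset.single_le_sum (f := fun y => max (z y - lev k (m + 1)) 0 ^ 2) (fun _ _ => sq_nonneg _) hmem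
  linarith

/-- The centre lies in every ball of the iteration. [folklore] -/
theorem centre_mem (x₀ : UT N) (R m j : ℕ) : dist x₀ x₀ ≤ ((rad R m j : ℕ) : ℝ) := by
  rw [dist_self]; exact Nat.cast_nonneg _

end

end Summit.QuantumFields.BalabanUV.Beta.DeGiorgiIteration
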